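import Summits.Ventures.Crystal3D.Theorems.StickyWulffConstantGenericWallFloorBarlowMachineSelector
import Summits.Ventures.Crystal3D.Theorems.StickyWulffConstantNoReconstructionGainBarlowGrainFilmCone
import HarnessLib

/-!
# Re-presenting a plate upside down: rises, up-bonds, selectors and zigzag polylines under the basal mirror
# (crux `GenericWallFloor`, stmt-Ventures-19480, line `WallLedgerG`; lane T's F4 — the `axisSign = −1` bridge, G-side)

HONEST FRAMING. Venture `Summits/Ventures/Crystal3D` (cell `crystal3d-full`), helper `--supports` the crux `GenericWallFloor`
(stmt-Ventures-19480) of `route-Ventures-StickyWulffConstant`, registered line `WallLedgerG`, open stub `stub_twoSlabAdhesion`.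
Rung credit only; F-C1 not moved; NOT the stub.  Pure bookkeeping.

F4 (`barlow_hlines_oriented`, `…BarlowOrientedGlue`) treats plates presented with their layer index increasing along the walk direction.
A plate `(L, σ)` with `(L⁻¹e)₂ < 0` is the same point set as `(L ∘ M, σ')`, `M` the basal mirror, `σ' n = −σ(−n−1)` (p639985:
`reversed_grain_mem`, `stacking_upFrame` of `…TexShadowCoverableDefs`), now with `((L∘M)⁻¹e)₂ > 0`.  Lane T's flux vocabulary is
indexed by the ORIGINAL `(L, σ)`; this file transports the selector data back:

* `bondRise_reverse`, `bilayerRise_reverse` — `bilayerRise (M.trans L) σ' e k = bilayerRise L σ e (−k−1)` (`σ` Hägg, `(L⁻¹e)₂ < 0`);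
* `isUpBond_reverse` — `IsUpBond (M.trans L) σ' e k d → IsUpBond L σ e (−k−1) (M d)`;
* `isZigSelector_reverse` — a selector of the flipped presentation, pushed through `M`, is a selector of the original;
* `zigVertexS_map` — `zigVertexS (M ∘ step) k = M (zigVertexS step k)`, and `M` fixes the layer lattice `t₀u + t₁v`
  (`basalMirror_uv`), so the window LINE SETS of the two presentations coincide point for point.
WHAT THIS IS NOT: not the glue itself (g8: apply `barlow_hlines_oriented` to the up-presentations and transport with these); F-C1 not moved.
-/

noncomputable section

namespace Summit.Ventures.Crystal3D.Theorems

open Finset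
open Literature.MathematicalPhysics.StatisticalMechanics
open Summit.Ventures.Crystal3D.Cruxes.TextureLiminf.TexShadow (upSlot₁ upSlot₂ upSlot₃ bondRise bilayerRise)
open scoped InnerProductSpace

/-- The inverse of `M.trans L` applied to `e` is `M (L⁻¹ e)`. -/
theorem symm_mirror_trans_apply (L : EuclideanSpace ℝ (Fin 3) ≃ₗᵢ[ℝ] EuclideanSpace ℝ (Fin 3)) (e : EuclideanSpace ℝ (Fin 3)) :
    (basalMirror.trans L).symm e = basalMirror (L.symm e) := by
  rw [LinearIsometryEquiv.symm_trans, LinearIsometryEquiv.trans_apply]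
  calc basalMirror.symm (L.symm e) = basalMirror.symm (basalMirror (basalMirror (L.symm e))) := by rw [basalMirror_basalMirror]
    _ = basalMirror (L.symm e) := basalMirror.symm_apply_apply _

/-- The basal mirror flips the third coordinate (local copy). -/
private theorem basalMirror_apply_two'' (w : EuclideanSpace ℝ (Fin 3)) : basalMirror w 2 = -w 2 := by
  rw [basalMirror_apply_coord]; simp

section Reverse

variable (L : EuclideanSpace ℝ (Fin 3) ≃ₗᵢ[ℝ] EuclideanSpace ℝ (Fin 3)) {σ : ℤ → ℤ} (hσ : IsHaggSeq σ) (e : EuclideanSpace ℝ (Fin 3))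
  (hneg : (L.symm e) 2 < 0)

include hσ hneg in
/-- **Bond rises of the flipped presentation**: `bondRise (M.trans L) σ' e k w = bondRise L σ e (−k−1) w`. -/
theorem bondRise_reverse (k : ℤ) (w : EuclideanSpace ℝ (Fin 3)) :
    bondRise (basalMirror.trans L) (fun n => -σ (-n - 1)) e k w = bondRise L σ e (-k - 1) w := by
  have hν' : (basalMirror.trans L).symm e = basalMirror (L.symm e) := symm_mirror_trans_apply L e
  have hpos' : 0 ≤ (basalMirror (L.symm e)) 2 := by rw [basalMirror_apply_two'']; linarith
  have hnot : ¬ 0 ≤ (L.symm e) 2 := not_le.2 hneg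
  unfold bondRise
  rw [hν', if_pos hpos', if_neg hnot, basalMirror_basalMirror]
  rcases hσ (-k - 1) with h | h
  · have h' : ¬ (-σ (-k - 1) = 1) := by rw [h]; decide
    rw [if_neg h', if_pos h]; ring
  · have h' : -σ (-k - 1) = 1 := by rw [h]; decide
    have h'' : ¬ σ (-k - 1) = 1 := by rw [h]; decide
    rw [if_pos h', if_neg h'']; ring

include hσ hneg in
/-- **Bilayer rises of the flipped presentation.** -/
theorem bilayerRise_reverse (k : ℤ) :
    bilayerRise (basalMirror.trans L) (fun n => -σ (-n - 1)) e k = bilayerRise L σ e (-k - 1) := by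
  simp only [bilayerRise, bondRise_reverse L hσ e hneg]

include hσ hneg in
/-- **Up-bonds of the flipped presentation, mirrored, are up-bonds of the original.** -/
theorem isUpBond_reverse (k : ℤ) (d : EuclideanSpace ℝ (Fin 3)) (hd : IsUpBond (basalMirror.trans L) (fun n => -σ (-n - 1)) e k d) :
    IsUpBond L σ e (-k - 1) (basalMirror d) := by
  have hν' : (basalMirror.trans L).symm e = basalMirror (L.symm e) := symm_mirror_trans_apply L e
  have hpos : 0 ≤ ((basalMirror.trans L).symm e) 2 := by rw [hν', basalMirror_apply_two'']; linarith
  have hnot : ¬ 0 ≤ (L.symm e) 2 := not_le.2 hneg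
  have hax' : axisSign (basalMirror.trans L) e = 1 := by unfold axisSign; rw [if_pos hpos]
  have hax : axisSign L e = -1 := by unfold axisSign; rw [if_neg hnot]
  obtain ⟨a, b, hab, hdeq⟩ := hd
  refine ⟨a, b, hab, ?_⟩
  rw [hdeq, hax', one_smul, hax]
  rcases hσ (-k - 1) with h | h
  · have h' : ¬ ((fun n => -σ (-n - 1)) k = 1) := by simp only [h]; decide
    rw [if_neg h', if_pos h]
    simp only [map_neg, basalMirror_basalMirror, neg_smul, one_smul]
  · have h' : (fun n => -σ (-n - 1)) k = 1 := by simp only [h]; decide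
    have h'' : ¬ σ (-k - 1) = 1 := by rw [h]; decide
    rw [if_pos h', if_neg h'']
    simp only [map_neg, neg_smul, one_smul, neg_neg]

include hσ hneg in
/-- **Selectors transport**: a selector of the flipped presentation, mirrored, is a selector of the original plate. -/
theorem isZigSelector_reverse {step : ℤ → EuclideanSpace ℝ (Fin 3)} (hsel : IsZigSelector (basalMirror.trans L) (fun n => -σ (-n - 1)) e step) :
    IsZigSelector L σ e (fun k => basalMirror (step k)) := by
  have hν' : (basalMirror.trans L).symm e = basalMirror (L.symm e) := symm_mirror_trans_apply L e
  have hpos : 0 ≤ ((basalMirror.trans L).symm e) 2 := by rw [hν', basalMirror_apply_two'']; linarith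
  have hnot : ¬ 0 ≤ (L.symm e) 2 := not_le.2 hneg
  have hslab : ∀ k, zigSlab L e k = -k - 1 := fun k => by unfold zigSlab; rw [if_neg hnot]
  have hslab' : ∀ k, zigSlab (basalMirror.trans L) e k = k := fun k => by unfold zigSlab; rw [if_pos hpos]
  intro k
  obtain ⟨hub, hrise⟩ := hsel k
  rw [hslab'] at hub hrise
  rw [hslab]
  refine ⟨isUpBond_reverse L hσ e hneg k (step k) hub, ?_⟩
  show ⟪basalMirror (step k), L.symm e⟫_ℝ = bilayerRise L σ e (-k - 1)
  rw [inner_basalMirror_comm, ← hν', hrise, bilayerRise_reverse L hσ e hneg]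

end Reverse

/-- **Polylines transport** through an additive map: `zigVertexS (M ∘ step) k = M (zigVertexS step k)`. -/
theorem zigVertexS_map (M : EuclideanSpace ℝ (Fin 3) ≃ₗᵢ[ℝ] EuclideanSpace ℝ (Fin 3)) (step : ℤ → EuclideanSpace ℝ (Fin 3)) (k : ℤ) :
    zigVertexS (fun k => M (step k)) k = M (zigVertexS step k) := by
  induction k using Int.induction_on with
  | zero => simp [zigVertexS_zero]
  | succ n ih => rw [zigVertexS_succ, zigVertexS_succ, ih, map_add]
  | pred n ih =>
    have h1 := zigVertexS_succ (fun k => M (step k)) (-(n : ℤ) - 1)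
    have h2 := zigVertexS_succ step (-(n : ℤ) - 1)
    rw [sub_add_cancel] at h1 h2
    rw [ih, h2, map_add] at h1
    exact add_right_cancel h1.symm

/-- The basal mirror fixes the layer lattice vectors `t₀u + t₁v`. -/
theorem basalMirror_uv (t : Fin 2 → ℤ) :
    basalMirror ((t 0 : ℝ) • triangularVec₁ 1 + (t 1 : ℝ) • triangularVec₂ 1) = (t 0 : ℝ) • triangularVec₁ 1 + (t 1 : ℝ) • triangularVec₂ 1 := by
  ext l
  rw [basalMirror_apply_coord]
  fin_cases l <;> simp [triangularVec₁, triangularVec₂]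

/-- **Window points coincide**: the moved vertex of the flipped presentation is the moved mirrored vertex of the original frame. -/
theorem moved_vertex_reverse (L : EuclideanSpace ℝ (Fin 3) ≃ₗᵢ[ℝ] EuclideanSpace ℝ (Fin 3)) (s : EuclideanSpace ℝ (Fin 3))
    (step : ℤ → EuclideanSpace ℝ (Fin 3)) (k : ℤ) (t : Fin 2 → ℤ) :
    (basalMirror.trans L) (zigVertexS step k + ((t 0 : ℝ) • triangularVec₁ 1 + (t 1 : ℝ) • triangularVec₂ 1)) + s =
      L (zigVertexS (fun k => basalMirror (step k)) k + ((t 0 : ℝ) • triangularVec₁ 1 + (t 1 : ℝ) • triangularVec₂ 1)) + s := by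
  rw [LinearIsometryEquiv.trans_apply, map_add, basalMirror_uv, zigVertexS_map]

end Summit.Ventures.Crystal3D.Theorems

end
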